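/-
Copyright: the b2b-balaban T⁴-continuum CRUX team, row NE7b leaf lineage `t4-ne7b-formalise-leaf-04` (gen 147). Project licence.
-/
import Literature.Analysis.Convexity.PrekopaLeindler
import Mathlib.MeasureTheory.Measure.Tilted
import Mathlib.Analysis.Calculus.ParametricIntegral
import Mathlib.Analysis.Calculus.DerivativeTest
import Mathlib.Analysis.Calculus.Deriv.Pow
import Mathlib.Analysis.SpecialFunctions.ExpDeriv
import Mathlib.Analysis.InnerProductSpace.PiL2
import Mathlib.MeasureTheory.Measure.Haar.InnerProductSpace

/-!
# THE BRASCAMP–LIEB VARIANCE INEQUALITY IN MAJORANT (BLOCK) FORM ON A CONVEX WINDOW: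
# `W(y) + x·g(y) + (x²∕2)·h(y)` jointly convex on a slab `(−r,r) × K` ⟹ `Var_{ν_{W,K}}(g) ≤ ∫ h dν_{W,K}`
# (row NE7b, node U5c; the convexity road's fluctuation step in HESSIAN currency — [folklore] real analysis, kernel theorems)

Cell `pub-balaban`, sub-cell `t4`, spine estimate NE7b (`T4WeightBudget.RelWeightBound`; the cell's OWN estimate — NOT PRINTED in [Bałaban 1983–89],
NOT PROVED).  Crux-route work under `Spine/NE7b/` (FREEZE (0) crux-prover clause) by leaf-04; NOTHING of Bałaban's is named, valued or asserted; no
`T4Continuum/Support` leaf typed; no `def`; zero `sorry`.  Imports: the tree's PROVED `Literature.Analysis.Convexity.prekopaLeindler_integral`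
(Brascamp–Lieb 1976 Thm 3.3) and Mathlib only — independent of the `BalabanUV` olean backlog.

WHY.  A renormalisation step produces the next exponent as a windowed fibre marginal `V⁺(x) = −log ∫_F e^{−V(x,y)} dy`; in HESSIAN currency (Brascamp–Lieb's
formula, `…NE7b.FibreWindowHessian` §6) `D²V⁺(x)[u,u] = ⟨∂ᵤᵤV⟩ − Var(∂ᵤV)` under the fibre tilt `ν = 1_F e^{−V(x,·)}∕Z`: a LOWER Hessian letter at the next scale
IS an UPPER bound on a fibre VARIANCE.  The tree holds Brascamp–Lieb's variance inequality with a SCALAR floor (`Literature.Probability.Moments.variance_tilted_le`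
on the carrier, `…NE7b.ConvexWindowBrascampLieb` on a convex window: `Var ≤ λ⁻¹∫‖Dg‖²`).  This file proves the MAJORANT («matrix», block) form — what a
block-Hessian display feeds, and what returns the fibre-AVERAGED Schur complement: if the augmented exponent `Φ(x,y) = W(y) + x·g(y) + (x²∕2)·h(y)` is jointly
convex on a slab `(−r,r) × K` (in Hessian currency: the block display `[[h, ∇gᵀ],[∇g, D²W]] ≽ 0` ON `K`, with slack), then `Var_{ν_{W,K}}(g) ≤ ∫ h dν_{W,K}`
(Gaussian check: `W = λ‖y‖²∕2`, `g` linear, `h ≡ ‖∇g‖²∕λ` is admissible and, on the whole space, gives equality).  ROUTE: Prékopa–Leindler at `s = ½` on the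
window gives `Z(x)Z(−x) ≤ Z(0)²` for the slab masses `Z(x) = ∫_K e^{−Φ(x,·)}`; the parametric integral is differentiated twice at `0` (`Z′(0) = −∫_K g e^{−W}`,
`Z″(0) = ∫_K (g² − h)e^{−W}`), and the necessary second-order condition at the interior maximum `0` of `x ↦ Z(x)Z(−x)` reads `Z(0)Z″(0) ≤ Z′(0)²` — the claim.
WHAT IS PROVED ([folklore]; [cite: BrascampLieb1976, Thm 4.1] for the inequality in its classical matrix form):
* §1 `setIntegral_exp_neg_mul_le_sq_of_midpoint` — Prékopa–Leindler at `s = ½` for `e^{−p}, e^{−q}, e^{−r}` restricted to a convex window, measurable data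
  (re-derived from the Literature theorem because `…NE7b.ConvexWindowBrascampLieb` §2 has no hub olean at the time of writing — disclosed).
* §2 slab masses: `hasDerivAt_exp_neg_slab(_mul)`, `slab_bounds` (`|x| ≤ 2`), `hasDerivAt_slabMass` (on `(−2,2)`), `hasDerivAt_slabMassDeriv_zero`.
* §3 `le_zero_of_isLocalMax_of_hasDerivAt` — a local maximum at `0` of an `f` differentiable near `0` with `f′` differentiable at `0` forces `f″(0) ≤ 0`.
* §4 **`mul_setIntegral_sq_sub_sq_le_of_midpoint`** (weighted form; weakest letter: the MIDPOINT inequality between `Φ(x,·)` and `Φ(−x,·)`),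
  **`mul_setIntegral_sq_sub_sq_le_of_convexOn`** (letter `ConvexOn ℝ (Ioo (−r) r ×ˢ K) Φ`, via `midpoint_of_convexOn`), and the tilted form
  **`sqIntegral_sub_sq_windowTilted_le_of_convexOn`**: `∫ g² dν − (∫ g dν)² ≤ ∫ h dν`, `ν = (volume.restrict K).tilted (−W)`.
* §5 **`negLogMass_hessianLetter_ge`** — the same in the letters of the Brascamp–Lieb Hessian formula: `(∫_K (b − h)e^{−W})∕Z ≤ −B∕Z + A²∕Z²`, `A = ∫_K −(e^{−W} g)`,
  `B = ∫_K e^{−W}(g² − b)` (read with `W = V(x,·)`, `g = ∂ᵤV(x,·)`, `b = ∂ᵤᵤV(x,·)`: `D²V⁺(x)[u,u] ≥ ⟨∂ᵤᵤV − h⟩_ν` for every admissible majorant `h`);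
  `convexOn_of_firstOrder` — the slab letter from a first-order letter with any field of linear functionals (entry for a Hessian display via
  `…NE7b.HessianFormFirstOrder` §1, `Q = 0`).
Letters: `K ⊆ ℝⁿ` convex, measurable, bounded (`volume K ≠ 0` for the ratio forms); `W, g, h` measurable with `w₀ ≤ W`, `|g| ≤ G`, `|h| ≤ H` ON `K` (displayed;
values off `K` never enter; continuity on the bounded window supplies them); the convexity letter on the slab.
NOT HERE (honest): the block-Hessian supplier of the slab letter for `C²` data (a line computation — junction material once `…HessianFormFirstOrder` ∕
`…FibreWindowHessian` have oleans); unbounded windows; which of print's steps are product-window marginals with which displays in which chart ((A3)∕(A1c),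
programme-sized, NC-NE7b-α UNRULED); anything of Bałaban's.  BY-NAME EFFECT ON THE WALL: NONE.  NE7b NOT PRINTED ∕ NOT PROVED; spine PROVED 0∕9; rung (B)+1
on a FINITE torus — NOT infinite volume, NOT the mass gap, NOT Clay.  HONEST DEPENDENCY: continuum YM on T⁴ ⇐ BetaPertH ∧ nine spine estimates (0/9
proved); BetaPertH ⇐ (D1) ∧ (D4) ∧ CAP+tail; G-an2-4 gates asym, D1 and NE2∕3∕4.
-/

set_option autoImplicit false

noncomputable section

open MeasureTheory Real Set Filter Topology

namespace Summit.QuantumFields.BalabanUV.T4Continuum.NE7b.ConvexWindowVarianceMajorant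

variable {n : ℕ}

/-! ## §1 Prékopa–Leindler at `s = ½` for exponentials restricted to a convex window -/

/-- **Prékopa–Leindler at `s = ½` ON A CONVEX WINDOW** (measurable data): if `r(½y₀ + ½y₁) ≤ (p y₀ + q y₁)∕2` for `y₀, y₁ ∈ K`, `K` convex measurable,
and `e^{−p}, e^{−q}, e^{−r}` are integrable on `K`, then `(∫_K e^{−p})(∫_K e^{−q}) ≤ (∫_K e^{−r})²`. [cite: BrascampLieb1976, Thm 3.3] -/
theorem setIntegral_exp_neg_mul_le_sq_of_midpoint {K : Set (EuclideanSpace ℝ (Fin n))} (hK : Convex ℝ K) (hKm : MeasurableSet K)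
    {p q r : EuclideanSpace ℝ (Fin n) → ℝ} (hp : Measurable p) (hq : Measurable q) (hr : Measurable r)
    (hpi : IntegrableOn (fun y => exp (-p y)) K) (hqi : IntegrableOn (fun y => exp (-q y)) K) (hri : IntegrableOn (fun y => exp (-r y)) K)
    (H : ∀ y₀ ∈ K, ∀ y₁ ∈ K, r ((1 / 2 : ℝ) • y₀ + (1 / 2 : ℝ) • y₁) ≤ (p y₀ + q y₁) / 2) :
    (∫ y in K, exp (-p y)) * (∫ y in K, exp (-q y)) ≤ (∫ y in K, exp (-r y)) ^ 2 := by
  have h0 : ∀ (u : EuclideanSpace ℝ (Fin n) → ℝ) (y : EuclideanSpace ℝ (Fin n)), 0 ≤ K.indicator (fun y => exp (-u y)) y :=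
    fun u y => Set.indicator_nonneg (fun _ _ => (exp_pos _).le) y
  have key := Literature.Analysis.Convexity.prekopaLeindler_integral (n := n) (s := 1 / 2) (by norm_num) (by norm_num)
    (hp.neg.exp.indicator hKm) (hq.neg.exp.indicator hKm) (hr.neg.exp.indicator hKm) (h0 p) (h0 q) (h0 r)
    (hpi.integrable_indicator hKm) (hqi.integrable_indicator hKm) (hri.integrable_indicator hKm)
    (fun y₀ y₁ => by
      by_cases hy₀ : y₀ ∈ K
      · by_cases hy₁ : y₁ ∈ K
        · have hm : (1 - 1 / 2 : ℝ) • y₀ + (1 / 2 : ℝ) • y₁ ∈ K := hK hy₀ hy₁ (by norm_num) (by norm_num) (by norm_num)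
          rw [indicator_of_mem hy₀, indicator_of_mem hy₁, indicator_of_mem hm, ← exp_mul, ← exp_mul, ← exp_add]
          apply exp_le_exp.2
          have := H y₀ hy₀ y₁ hy₁
          norm_num at this ⊢
          linarith
        · rw [indicator_of_notMem hy₁, Real.zero_rpow (by norm_num), mul_zero]
          exact h0 r _
      · rw [indicator_of_notMem hy₀, Real.zero_rpow (by norm_num), zero_mul]
        exact h0 r _)
  rw [integral_indicator hKm, integral_indicator hKm, integral_indicator hKm] at key
  have h0p : 0 ≤ ∫ y in K, exp (-p y) := integral_nonneg fun _ => (exp_pos _).le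
  have h0q : 0 ≤ ∫ y in K, exp (-q y) := integral_nonneg fun _ => (exp_pos _).le
  norm_num at key
  have hsq : ((∫ y in K, exp (-p y)) ^ (1 / 2 : ℝ) * (∫ y in K, exp (-q y)) ^ (1 / 2 : ℝ)) ^ 2 = (∫ y in K, exp (-p y)) * (∫ y in K, exp (-q y)) := by
    rw [mul_pow, ← rpow_natCast, ← rpow_natCast, ← rpow_mul h0p, ← rpow_mul h0q]
    norm_num
  rw [← hsq]
  exact pow_le_pow_left₀ (by positivity) key 2

/-! ## §2 The slab masses `Z(x) = ∫_K e^{−(W + x·g + (x²∕2)·h)}`: pointwise derivatives, bounds, parametric differentiation -/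

section Slab

variable {K : Set (EuclideanSpace ℝ (Fin n))} {W g h : EuclideanSpace ℝ (Fin n) → ℝ} {w₀ G H : ℝ}

/-- `∂ₓ e^{−(W + xg + x²h∕2)} = e^{−(…)}·(−(g + xh))`. [folklore] -/
theorem hasDerivAt_exp_neg_slab (y : EuclideanSpace ℝ (Fin n)) (x : ℝ) :
    HasDerivAt (fun x : ℝ => exp (-(W y + x * g y + x ^ 2 / 2 * h y))) (exp (-(W y + x * g y + x ^ 2 / 2 * h y)) * (-(g y + x * h y))) x := by
  have ha : HasDerivAt (fun x : ℝ => x * g y) (1 * g y) x := (hasDerivAt_id' x).mul_const (g y)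
  have hb : HasDerivAt (fun x : ℝ => x ^ 2 / 2 * h y) (x * h y) x :=
    (((hasDerivAt_pow 2 x).div_const 2).mul_const (h y)).congr_deriv (by norm_num)
  exact (((ha.const_add (W y)).fun_add hb).congr_deriv (by ring)).neg.exp

/-- `∂ₓ [e^{−(W + xg + x²h∕2)}·(−(g + xh))] = e^{−(…)}(g + xh)² − e^{−(…)}h` (product rule). [folklore] -/
theorem hasDerivAt_exp_neg_slab_mul (y : EuclideanSpace ℝ (Fin n)) (x : ℝ) :
    HasDerivAt (fun x : ℝ => exp (-(W y + x * g y + x ^ 2 / 2 * h y)) * (-(g y + x * h y)))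
      (exp (-(W y + x * g y + x ^ 2 / 2 * h y)) * (-(g y + x * h y)) * (-(g y + x * h y)) +
        exp (-(W y + x * g y + x ^ 2 / 2 * h y)) * (-(1 * h y))) x :=
  (hasDerivAt_exp_neg_slab (W := W) (g := g) (h := h) y x).mul (((hasDerivAt_id' x).mul_const (h y)).const_add (g y)).neg

/-- On the window, for `|x| ≤ 2`: `e^{−(W + xg + x²h∕2)} ≤ e^{−(w₀ − 2G − 2H)}` and `|g + xh| ≤ G + 2H`. [folklore] -/
theorem slab_bounds (hWl : ∀ y ∈ K, w₀ ≤ W y) (hgb : ∀ y ∈ K, |g y| ≤ G) (hhb : ∀ y ∈ K, |h y| ≤ H) {x : ℝ} (hx : |x| ≤ 2)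
    {y : EuclideanSpace ℝ (Fin n)} (hy : y ∈ K) :
    exp (-(W y + x * g y + x ^ 2 / 2 * h y)) ≤ exp (-(w₀ - 2 * G - 2 * H)) ∧ |g y + x * h y| ≤ G + 2 * H := by
  have h1 : |x * g y| ≤ 2 * G := by rw [abs_mul]; exact mul_le_mul hx (hgb y hy) (abs_nonneg _) (by norm_num)
  have hx2 : x ^ 2 / 2 ≤ 2 := by nlinarith [abs_nonneg x, sq_abs x, hx]
  have h2 : |x ^ 2 / 2 * h y| ≤ 2 * H := by
    rw [abs_mul, abs_of_nonneg (by positivity : (0 : ℝ) ≤ x ^ 2 / 2)]; exact mul_le_mul hx2 (hhb y hy) (abs_nonneg _) (by norm_num)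
  have h3 : |x * h y| ≤ 2 * H := by rw [abs_mul]; exact mul_le_mul hx (hhb y hy) (abs_nonneg _) (by norm_num)
  refine ⟨exp_le_exp.2 (neg_le_neg ?_), (abs_add_le _ _).trans (add_le_add (hgb y hy) h3)⟩
  linarith [hWl y hy, neg_abs_le (x * g y), neg_abs_le (x ^ 2 / 2 * h y)]

/-- The slab density is measurable. [folklore] -/
theorem measurable_exp_neg_slab (hWm : Measurable W) (hgm : Measurable g) (hhm : Measurable h) (x : ℝ) :
    Measurable fun y => exp (-(W y + x * g y + x ^ 2 / 2 * h y)) :=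
  ((hWm.add (hgm.const_mul x)).add (hhm.const_mul (x ^ 2 / 2))).neg.exp

/-- The slab density is integrable on a bounded window for `|x| ≤ 2`. [folklore] -/
theorem integrableOn_exp_neg_slab (hKm : MeasurableSet K) (hKb : Bornology.IsBounded K) (hWm : Measurable W) (hgm : Measurable g)
    (hhm : Measurable h) (hWl : ∀ y ∈ K, w₀ ≤ W y) (hgb : ∀ y ∈ K, |g y| ≤ G) (hhb : ∀ y ∈ K, |h y| ≤ H) {x : ℝ} (hx : |x| ≤ 2) :
    IntegrableOn (fun y => exp (-(W y + x * g y + x ^ 2 / 2 * h y))) K := by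
  haveI : IsFiniteMeasure (volume.restrict K) := isFiniteMeasure_restrict.2 hKb.measure_lt_top.ne
  refine (integrable_const (exp (-(w₀ - 2 * G - 2 * H)))).mono' (measurable_exp_neg_slab hWm hgm hhm x).aestronglyMeasurable ?_
  refine (ae_restrict_iff' hKm).2 (ae_of_all _ fun y hy => ?_)
  rw [Real.norm_eq_abs, abs_of_pos (exp_pos _)]
  exact (slab_bounds hWl hgb hhb hx hy).1

/-- `∫_K φ e^{−W}` is integrable on a bounded window for bounded measurable `φ`. [folklore] -/
theorem integrableOn_mul_exp_neg (hKm : MeasurableSet K) (hKb : Bornology.IsBounded K) (hWm : Measurable W) (hWl : ∀ y ∈ K, w₀ ≤ W y)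
    {φ : EuclideanSpace ℝ (Fin n) → ℝ} (hφm : Measurable φ) {C : ℝ} (hφb : ∀ y ∈ K, |φ y| ≤ C) : IntegrableOn (fun y => φ y * exp (-W y)) K := by
  haveI : IsFiniteMeasure (volume.restrict K) := isFiniteMeasure_restrict.2 hKb.measure_lt_top.ne
  refine (integrable_const (C * exp (-w₀))).mono' (hφm.mul hWm.neg.exp).aestronglyMeasurable ((ae_restrict_iff' hKm).2 (ae_of_all _ fun y hy => ?_))
  rw [Real.norm_eq_abs, abs_mul, abs_of_pos (exp_pos _)]
  exact mul_le_mul (hφb y hy) (exp_le_exp.2 (neg_le_neg (hWl y hy))) (exp_pos _).le ((abs_nonneg _).trans (hφb y hy))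

/-- **THE SLAB MASS IS DIFFERENTIABLE** on `(−2, 2)`: `Z′(x₀) = ∫_K e^{−Φ(x₀,·)}·(−(g + x₀h))` (dominated differentiation; bounded window, bounded data).
[folklore] -/
theorem hasDerivAt_slabMass (hKm : MeasurableSet K) (hKb : Bornology.IsBounded K) (hWm : Measurable W) (hgm : Measurable g) (hhm : Measurable h)
    (hWl : ∀ y ∈ K, w₀ ≤ W y) (hgb : ∀ y ∈ K, |g y| ≤ G) (hhb : ∀ y ∈ K, |h y| ≤ H) {x₀ : ℝ} (hx₀ : x₀ ∈ Ioo (-2 : ℝ) 2) :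
    HasDerivAt (fun x : ℝ => ∫ y in K, exp (-(W y + x * g y + x ^ 2 / 2 * h y)))
      (∫ y in K, exp (-(W y + x₀ * g y + x₀ ^ 2 / 2 * h y)) * (-(g y + x₀ * h y))) x₀ := by
  haveI : IsFiniteMeasure (volume.restrict K) := isFiniteMeasure_restrict.2 hKb.measure_lt_top.ne
  refine (hasDerivAt_integral_of_dominated_loc_of_deriv_le (Ioo_mem_nhds hx₀.1 hx₀.2)
    (Eventually.of_forall fun x => (measurable_exp_neg_slab hWm hgm hhm x).aestronglyMeasurable)
    (integrableOn_exp_neg_slab hKm hKb hWm hgm hhm hWl hgb hhb (abs_lt.2 ⟨hx₀.1, hx₀.2⟩).le)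
    ((measurable_exp_neg_slab hWm hgm hhm x₀).mul (hgm.add (hhm.const_mul x₀)).neg).aestronglyMeasurable
    (bound := fun _ => exp (-(w₀ - 2 * G - 2 * H)) * (G + 2 * H)) ((ae_restrict_iff' hKm).2 (ae_of_all _ fun y hy x hx => ?_))
    (integrable_const _) (ae_of_all _ fun y x _ => hasDerivAt_exp_neg_slab y x)).2
  have hb := slab_bounds hWl hgb hhb (abs_lt.2 ⟨hx.1, hx.2⟩).le hy
  rw [norm_mul, Real.norm_eq_abs, Real.norm_eq_abs, abs_of_pos (exp_pos _), abs_neg]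
  exact mul_le_mul hb.1 hb.2 (abs_nonneg _) (exp_pos _).le

/-- **THE DERIVATIVE OF THE SLAB MASS IS DIFFERENTIABLE AT `0`**, with `Z″(0) = ∫_K (g² − h) e^{−W}`. [folklore] -/
theorem hasDerivAt_slabMassDeriv_zero (hKm : MeasurableSet K) (hKb : Bornology.IsBounded K) (hWm : Measurable W) (hgm : Measurable g)
    (hhm : Measurable h) (hWl : ∀ y ∈ K, w₀ ≤ W y) (hgb : ∀ y ∈ K, |g y| ≤ G) (hhb : ∀ y ∈ K, |h y| ≤ H) :
    HasDerivAt (fun x : ℝ => ∫ y in K, exp (-(W y + x * g y + x ^ 2 / 2 * h y)) * (-(g y + x * h y))) (∫ y in K, (g y ^ 2 - h y) * exp (-W y)) 0 := by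
  haveI : IsFiniteMeasure (volume.restrict K) := isFiniteMeasure_restrict.2 hKb.measure_lt_top.ne
  have hmeasF : ∀ x : ℝ, Measurable fun y => exp (-(W y + x * g y + x ^ 2 / 2 * h y)) * (-(g y + x * h y)) :=
    fun x => (measurable_exp_neg_slab hWm hgm hhm x).mul (hgm.add (hhm.const_mul x)).neg
  have h0 : |(0 : ℝ)| ≤ 2 := by norm_num
  have hF_int : Integrable (fun y => exp (-(W y + 0 * g y + 0 ^ 2 / 2 * h y)) * (-(g y + 0 * h y))) (volume.restrict K) := by
    refine (integrable_const (exp (-(w₀ - 2 * G - 2 * H)) * (G + 2 * H))).mono' (hmeasF 0).aestronglyMeasurable ?_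
    refine (ae_restrict_iff' hKm).2 (ae_of_all _ fun y hy => ?_)
    rw [norm_mul, Real.norm_eq_abs, Real.norm_eq_abs, abs_of_pos (exp_pos _), abs_neg]
    exact mul_le_mul (slab_bounds hWl hgb hhb h0 hy).1 (slab_bounds hWl hgb hhb h0 hy).2 (abs_nonneg _) (exp_pos _).le
  have hF'_meas : AEStronglyMeasurable (fun y => exp (-(W y + 0 * g y + 0 ^ 2 / 2 * h y)) * (-(g y + 0 * h y)) * (-(g y + 0 * h y)) +
      exp (-(W y + 0 * g y + 0 ^ 2 / 2 * h y)) * (-(1 * h y))) (volume.restrict K) :=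
    (((hmeasF 0).mul (hgm.add (hhm.const_mul 0)).neg).add ((measurable_exp_neg_slab hWm hgm hhm 0).mul (hhm.const_mul 1).neg)).aestronglyMeasurable
  have h_bound : ∀ᵐ y ∂(volume.restrict K), ∀ x ∈ Ioo (-2 : ℝ) 2,
      ‖exp (-(W y + x * g y + x ^ 2 / 2 * h y)) * (-(g y + x * h y)) * (-(g y + x * h y)) + exp (-(W y + x * g y + x ^ 2 / 2 * h y)) * (-(1 * h y))‖ ≤
        exp (-(w₀ - 2 * G - 2 * H)) * ((G + 2 * H) * (G + 2 * H)) + exp (-(w₀ - 2 * G - 2 * H)) * H := by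
    refine (ae_restrict_iff' hKm).2 (ae_of_all _ fun y hy x hx => ?_)
    obtain ⟨he, hl⟩ := slab_bounds hWl hgb hhb (abs_lt.2 ⟨hx.1, hx.2⟩).le hy
    refine (norm_add_le _ _).trans (add_le_add ?_ ?_)
    · rw [norm_mul, norm_mul, Real.norm_eq_abs, Real.norm_eq_abs, abs_of_pos (exp_pos _), abs_neg, mul_assoc]
      exact mul_le_mul he (mul_le_mul hl hl (abs_nonneg _) ((abs_nonneg _).trans hl)) (by positivity) (exp_pos _).le
    · rw [norm_mul, Real.norm_eq_abs, Real.norm_eq_abs, abs_of_pos (exp_pos _), abs_neg, one_mul]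
      exact mul_le_mul he (hhb y hy) (abs_nonneg _) (exp_pos _).le
  have key := (hasDerivAt_integral_of_dominated_loc_of_deriv_le (Ioo_mem_nhds (by norm_num) (by norm_num))
    (Eventually.of_forall fun x => (hmeasF x).aestronglyMeasurable) hF_int hF'_meas h_bound (integrable_const _)
    (ae_of_all _ fun y x _ => hasDerivAt_exp_neg_slab_mul y x)).2
  have hcongr : (∫ y in K, (exp (-(W y + 0 * g y + 0 ^ 2 / 2 * h y)) * (-(g y + 0 * h y)) * (-(g y + 0 * h y)) +
      exp (-(W y + 0 * g y + 0 ^ 2 / 2 * h y)) * (-(1 * h y)))) = ∫ y in K, (g y ^ 2 - h y) * exp (-W y) := by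
    refine integral_congr_ae (ae_of_all _ fun y => ?_)
    simp only [zero_mul, add_zero, ne_eq, OfNat.ofNat_ne_zero, not_false_eq_true, zero_pow, zero_div, one_mul]
    ring
  rwa [hcongr] at key

end Slab

/-! ## §3 The necessary second-order condition at an interior maximum -/

/-- **`f″(0) ≤ 0` AT A LOCAL MAXIMUM**: `f` with derivative `f′ x` at every `x` near `0`, `f′` with derivative `c` at `0`, and a local maximum of `f` at `0`
force `c ≤ 0` (Mathlib's `isLocalMin_of_deriv_deriv_pos` run backwards: were `c > 0`, `0` would also be a local minimum, `f` locally constant, `c = 0`).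
[folklore] -/
theorem le_zero_of_isLocalMax_of_hasDerivAt {f f' : ℝ → ℝ} {c : ℝ} (hf : ∀ᶠ x in 𝓝 (0 : ℝ), HasDerivAt f (f' x) x) (hf' : HasDerivAt f' c 0)
    (hmax : IsLocalMax f 0) : c ≤ 0 := by
  by_contra hc
  push Not at hc
  have hderiv : deriv f =ᶠ[𝓝 (0 : ℝ)] f' := hf.mono fun x hx => hx.deriv
  have h2 : deriv (deriv f) 0 = c := by rw [hderiv.deriv_eq]; exact hf'.deriv
  have hmin : IsLocalMin f 0 := isLocalMin_of_deriv_deriv_pos (by rw [h2]; exact hc) hmax.deriv_eq_zero hf.self_of_nhds.continuousAt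
  have heq : f =ᶠ[𝓝 (0 : ℝ)] fun _ => f 0 := (hmax.and hmin).mono fun s hs => le_antisymm hs.1 hs.2
  have h3 : deriv (deriv f) 0 = 0 := by rw [(heq.deriv : deriv f =ᶠ[𝓝 (0 : ℝ)] deriv fun _ : ℝ => f 0).deriv_eq]; simp
  linarith

/-! ## §4 The variance inequality in majorant form -/

section Main

variable {K : Set (EuclideanSpace ℝ (Fin n))} {W g h b : EuclideanSpace ℝ (Fin n) → ℝ} {w₀ G H B₀ r : ℝ}

/-- **BRASCAMP–LIEB IN MAJORANT FORM ON A CONVEX WINDOW, weighted integrals, weakest letter.**  `K ⊆ ℝⁿ` convex, measurable, bounded; `W, g, h` measurable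
with `w₀ ≤ W`, `|g| ≤ G`, `|h| ≤ H` on `K`; for every `x ∈ (−r, r)` (`r > 0`) the MIDPOINT letter `W(½y₀ + ½y₁) ≤ (Φ(x,y₀) + Φ(−x,y₁))∕2` for `y₀, y₁ ∈ K`,
`Φ(x,y) = W y + x g y + x² h y∕2`.  Then `(∫_K e^{−W})(∫_K g² e^{−W}) − (∫_K g e^{−W})² ≤ (∫_K e^{−W})(∫_K h e^{−W})`. [cite: BrascampLieb1976, Thm 4.1] -/
theorem mul_setIntegral_sq_sub_sq_le_of_midpoint (hK : Convex ℝ K) (hKm : MeasurableSet K) (hKb : Bornology.IsBounded K)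
    (hWm : Measurable W) (hgm : Measurable g) (hhm : Measurable h) (hWl : ∀ y ∈ K, w₀ ≤ W y) (hgb : ∀ y ∈ K, |g y| ≤ G) (hhb : ∀ y ∈ K, |h y| ≤ H)
    (hr : 0 < r) (hmid : ∀ x ∈ Ioo (-r) r, ∀ y₀ ∈ K, ∀ y₁ ∈ K,
      W ((1 / 2 : ℝ) • y₀ + (1 / 2 : ℝ) • y₁) ≤ ((W y₀ + x * g y₀ + x ^ 2 / 2 * h y₀) + (W y₁ + -x * g y₁ + (-x) ^ 2 / 2 * h y₁)) / 2) :
    (∫ y in K, exp (-W y)) * (∫ y in K, g y ^ 2 * exp (-W y)) - (∫ y in K, g y * exp (-W y)) ^ 2 ≤ (∫ y in K, exp (-W y)) * ∫ y in K, h y * exp (-W y) := by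
  haveI : IsFiniteMeasure (volume.restrict K) := isFiniteMeasure_restrict.2 hKb.measure_lt_top.ne
  -- the slab mass, its derivative, its second derivative at `0`
  set Z : ℝ → ℝ := fun x => ∫ y in K, exp (-(W y + x * g y + x ^ 2 / 2 * h y)) with hZ
  set Z₁ : ℝ → ℝ := fun x => ∫ y in K, exp (-(W y + x * g y + x ^ 2 / 2 * h y)) * (-(g y + x * h y)) with hZ₁
  set Z₂ : ℝ := ∫ y in K, (g y ^ 2 - h y) * exp (-W y) with hZ₂
  have hZd : ∀ x ∈ Ioo (-2 : ℝ) 2, HasDerivAt Z (Z₁ x) x := fun x hx => hasDerivAt_slabMass hKm hKb hWm hgm hhm hWl hgb hhb hx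
  have hZ₁d : HasDerivAt Z₁ Z₂ 0 := hasDerivAt_slabMassDeriv_zero hKm hKb hWm hgm hhm hWl hgb hhb
  have hZ0 : Z 0 = ∫ y in K, exp (-W y) := by simp only [hZ]; exact integral_congr_ae (ae_of_all _ fun y => by simp)
  have hZ₁0 : Z₁ 0 = -∫ y in K, g y * exp (-W y) := by
    simp only [hZ₁]; rw [← integral_neg]; refine integral_congr_ae (ae_of_all _ fun y => ?_)
    simp only [zero_mul, add_zero, ne_eq, OfNat.ofNat_ne_zero, not_false_eq_true, zero_pow, zero_div]; ring
  have hgi : IntegrableOn (fun y => g y ^ 2 * exp (-W y)) K :=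
    integrableOn_mul_exp_neg hKm hKb hWm hWl (hgm.pow_const 2) (C := G ^ 2) fun y hy => by rw [abs_pow]; exact pow_le_pow_left₀ (abs_nonneg _) (hgb y hy) 2
  have hZ₂' : Z₂ = (∫ y in K, g y ^ 2 * exp (-W y)) - ∫ y in K, h y * exp (-W y) := by
    simp only [hZ₂]; rw [← integral_sub hgi (integrableOn_mul_exp_neg hKm hKb hWm hWl hhm hhb)]
    exact integral_congr_ae (ae_of_all _ fun y => by ring)
  -- the product `P(x) = Z(x)Z(−x)`, its derivative near `0`, its second derivative at `0`
  set P : ℝ → ℝ := fun x => Z x * Z (-x) with hP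
  set P' : ℝ → ℝ := fun x => Z₁ x * Z (-x) + Z x * (Z₁ (-x) * -1) with hP'
  have hPd : ∀ᶠ x in 𝓝 (0 : ℝ), HasDerivAt P (P' x) x := by
    filter_upwards [Ioo_mem_nhds (by norm_num : (-1 : ℝ) < 0) (by norm_num : (0 : ℝ) < 1)] with x hx
    exact (hZd x ⟨by linarith [hx.1], by linarith [hx.2]⟩).mul ((hZd (-x) ⟨by linarith [hx.2], by linarith [hx.1]⟩).comp x (hasDerivAt_neg x))
  have hZ₁dneg : HasDerivAt (fun x => Z₁ (-x)) (Z₂ * -1) 0 := by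
    have h' := hZ₁d; rw [← neg_zero] at h'; exact h'.comp (0 : ℝ) (hasDerivAt_neg 0)
  have hP'd : HasDerivAt P' (Z₂ * Z (-0) + Z₁ 0 * (Z₁ (-0) * -1) + (Z₁ 0 * (Z₁ (-0) * -1) + Z 0 * (Z₂ * -1 * -1))) 0 :=
    (hZ₁d.mul ((hZd (-0) (by norm_num)).comp (0 : ℝ) (hasDerivAt_neg 0))).add ((hZd 0 (by norm_num)).mul (hZ₁dneg.mul_const (-1)))
  -- `0` is a local maximum of `P`: Prékopa–Leindler at `s = ½` with the midpoint letter
  have hmax : IsLocalMax P 0 := by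
    have hm : min r 2 > 0 := lt_min hr (by norm_num)
    filter_upwards [Ioo_mem_nhds (neg_lt_zero.2 hm) hm] with x hx
    have hxr : x ∈ Ioo (-r) r := ⟨lt_of_le_of_lt (neg_le_neg (min_le_left r 2)) hx.1, lt_of_lt_of_le hx.2 (min_le_left r 2)⟩
    have hx2 : |x| ≤ 2 := (abs_lt.2 ⟨lt_of_le_of_lt (neg_le_neg (min_le_right r 2)) hx.1, lt_of_lt_of_le hx.2 (min_le_right r 2)⟩).le
    have hx2' : |(-x)| ≤ 2 := by rwa [abs_neg]
    have hPL := setIntegral_exp_neg_mul_le_sq_of_midpoint hK hKm (p := fun y => W y + x * g y + x ^ 2 / 2 * h y)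
      (q := fun y => W y + -x * g y + (-x) ^ 2 / 2 * h y) (r := W) ((hWm.add (hgm.const_mul x)).add (hhm.const_mul (x ^ 2 / 2)))
      ((hWm.add (hgm.const_mul (-x))).add (hhm.const_mul ((-x) ^ 2 / 2))) hWm (integrableOn_exp_neg_slab hKm hKb hWm hgm hhm hWl hgb hhb hx2)
      (integrableOn_exp_neg_slab hKm hKb hWm hgm hhm hWl hgb hhb hx2')
      (by simpa using integrableOn_exp_neg_slab hKm hKb hWm hgm hhm hWl hgb hhb (x := 0) (by norm_num)) (hmid x hxr)
    rw [show P 0 = (∫ y in K, exp (-W y)) ^ 2 by simp only [hP, neg_zero]; rw [hZ0, sq]]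
    exact hPL
  -- second order at the maximum
  have hc := le_zero_of_isLocalMax_of_hasDerivAt hPd hP'd hmax
  simp only [neg_zero] at hc
  rw [hZ0, hZ₁0, hZ₂'] at hc
  nlinarith [hc]

/-- The midpoint letter from the `ConvexOn` letter on the slab. [folklore] -/
theorem midpoint_of_convexOn (hconv : ConvexOn ℝ (Ioo (-r) r ×ˢ K) (fun p : ℝ × EuclideanSpace ℝ (Fin n) => W p.2 + p.1 * g p.2 + p.1 ^ 2 / 2 * h p.2)) :
    ∀ x ∈ Ioo (-r) r, ∀ y₀ ∈ K, ∀ y₁ ∈ K,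
      W ((1 / 2 : ℝ) • y₀ + (1 / 2 : ℝ) • y₁) ≤ ((W y₀ + x * g y₀ + x ^ 2 / 2 * h y₀) + (W y₁ + -x * g y₁ + (-x) ^ 2 / 2 * h y₁)) / 2 := by
  intro x hx y₀ hy₀ y₁ hy₁
  have key := hconv.2 (show ((x, y₀) : ℝ × EuclideanSpace ℝ (Fin n)) ∈ Ioo (-r) r ×ˢ K from ⟨hx, hy₀⟩)
    (show ((-x, y₁) : ℝ × EuclideanSpace ℝ (Fin n)) ∈ Ioo (-r) r ×ˢ K from ⟨⟨by linarith [hx.2], by linarith [hx.1]⟩, hy₁⟩)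
    (by norm_num : (0 : ℝ) ≤ 1 / 2) (by norm_num : (0 : ℝ) ≤ 1 / 2) (by norm_num)
  simp only [Prod.smul_mk, Prod.mk_add_mk, smul_eq_mul] at key
  rw [show (1 / 2 : ℝ) * x + 1 / 2 * -x = 0 by ring] at key
  simp only [zero_mul, add_zero, ne_eq, OfNat.ofNat_ne_zero, not_false_eq_true, zero_pow, zero_div] at key
  linarith

/-- **BRASCAMP–LIEB IN MAJORANT FORM ON A CONVEX WINDOW, weighted integrals, `ConvexOn` letter**: as `mul_setIntegral_sq_sub_sq_le_of_midpoint`, the letter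
being joint convexity of `(x,y) ↦ W y + x g y + x² h y∕2` on the slab `Ioo (−r) r ×ˢ K`. [cite: BrascampLieb1976, Thm 4.1] -/
theorem mul_setIntegral_sq_sub_sq_le_of_convexOn (hK : Convex ℝ K) (hKm : MeasurableSet K) (hKb : Bornology.IsBounded K)
    (hWm : Measurable W) (hgm : Measurable g) (hhm : Measurable h) (hWl : ∀ y ∈ K, w₀ ≤ W y) (hgb : ∀ y ∈ K, |g y| ≤ G) (hhb : ∀ y ∈ K, |h y| ≤ H)
    (hr : 0 < r) (hconv : ConvexOn ℝ (Ioo (-r) r ×ˢ K) (fun p : ℝ × EuclideanSpace ℝ (Fin n) => W p.2 + p.1 * g p.2 + p.1 ^ 2 / 2 * h p.2)) :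
    (∫ y in K, exp (-W y)) * (∫ y in K, g y ^ 2 * exp (-W y)) - (∫ y in K, g y * exp (-W y)) ^ 2 ≤ (∫ y in K, exp (-W y)) * ∫ y in K, h y * exp (-W y) :=
  mul_setIntegral_sq_sub_sq_le_of_midpoint hK hKm hKb hWm hgm hhm hWl hgb hhb hr (midpoint_of_convexOn hconv)

/-- Transfer: an integral against the windowed tilt `ν_{W,K} = (volume.restrict K).tilted (−W)` is the weighted window integral over the window mass. [folklore] -/
theorem integral_windowTilted_eq_div (φ : EuclideanSpace ℝ (Fin n) → ℝ) :
    ∫ y, φ y ∂((volume.restrict K).tilted fun y => -W y) = (∫ y in K, φ y * exp (-W y)) / ∫ y in K, exp (-W y) := by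
  rw [integral_tilted, ← integral_div]
  exact integral_congr_ae (ae_of_all _ fun y => by simp only [smul_eq_mul]; ring)

/-- **BRASCAMP–LIEB IN MAJORANT FORM ON A CONVEX WINDOW, tilted form**: `K` convex, measurable, bounded, `volume K ≠ 0`; `W, g, h` measurable, bounded as displayed
on `K`; `(x,y) ↦ W y + x g y + x² h y∕2` convex on `Ioo (−r) r ×ˢ K`.  Then for the windowed tilt `ν = 1_K e^{−W} ∕ ∫_K e^{−W}`:
`∫ g² dν − (∫ g dν)² ≤ ∫ h dν`. [cite: BrascampLieb1976, Thm 4.1] -/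
theorem sqIntegral_sub_sq_windowTilted_le_of_convexOn (hK : Convex ℝ K) (hKm : MeasurableSet K) (hKb : Bornology.IsBounded K) (hK0 : volume K ≠ 0)
    (hWm : Measurable W) (hgm : Measurable g) (hhm : Measurable h) (hWl : ∀ y ∈ K, w₀ ≤ W y) (hgb : ∀ y ∈ K, |g y| ≤ G) (hhb : ∀ y ∈ K, |h y| ≤ H)
    (hr : 0 < r) (hconv : ConvexOn ℝ (Ioo (-r) r ×ˢ K) (fun p : ℝ × EuclideanSpace ℝ (Fin n) => W p.2 + p.1 * g p.2 + p.1 ^ 2 / 2 * h p.2)) :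
    ∫ y, g y ^ 2 ∂((volume.restrict K).tilted fun y => -W y) - (∫ y, g y ∂((volume.restrict K).tilted fun y => -W y)) ^ 2 ≤
      ∫ y, h y ∂((volume.restrict K).tilted fun y => -W y) := by
  haveI : NeZero (volume.restrict K) := ⟨fun h0 => hK0 (Measure.restrict_eq_zero.1 h0)⟩
  have key := mul_setIntegral_sq_sub_sq_le_of_convexOn hK hKm hKb hWm hgm hhm hWl hgb hhb hr hconv
  have hZi : IntegrableOn (fun y => exp (-W y)) K := by simpa using integrableOn_exp_neg_slab hKm hKb hWm hgm hhm hWl hgb hhb (x := 0) (by norm_num)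
  have hZpos : 0 < ∫ y in K, exp (-W y) := integral_exp_pos hZi
  rw [integral_windowTilted_eq_div, integral_windowTilted_eq_div, integral_windowTilted_eq_div]
  set Z : ℝ := ∫ y in K, exp (-W y)
  have hZne : Z ≠ 0 := hZpos.ne'
  rw [show (∫ y in K, g y ^ 2 * exp (-W y)) / Z - ((∫ y in K, g y * exp (-W y)) / Z) ^ 2 =
      (Z * (∫ y in K, g y ^ 2 * exp (-W y)) - (∫ y in K, g y * exp (-W y)) ^ 2) / Z ^ 2 by field_simp,
    show (∫ y in K, h y * exp (-W y)) / Z = (Z * ∫ y in K, h y * exp (-W y)) / Z ^ 2 by field_simp]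
  exact div_le_div_of_nonneg_right key (sq_nonneg Z)

/-! ## §5 The END in the letters of the Brascamp–Lieb Hessian formula; suppliers of the letters -/

/-- **THE FIBRE-AVERAGED SCHUR LETTER.**  In the letters of the Brascamp–Lieb Hessian formula for a windowed marginal (`D²V⁺(x)[u,u] = −B∕Z + A²∕Z²`, `Z = ∫_K e^{−W}`,
`A = ∫_K −(e^{−W}·g)`, `B = ∫_K e^{−W}·(g² − b)`, where `W = V(x,·)`, `g = ∂ᵤV(x,·)`, `b = ∂ᵤᵤV(x,·)`): under the hypotheses of
`mul_setIntegral_sq_sub_sq_le_of_convexOn` (and `b` measurable, bounded on `K`, `volume K ≠ 0`), `(∫_K (b − h)e^{−W})∕Z ≤ −B∕Z + A²∕Z²` — i.e.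
`D²V⁺(x)[u,u] ≥ ⟨∂ᵤᵤV − h⟩_ν` for every admissible majorant `h`. [folklore] -/
theorem negLogMass_hessianLetter_ge (hK : Convex ℝ K) (hKm : MeasurableSet K) (hKb : Bornology.IsBounded K) (hK0 : volume K ≠ 0)
    (hWm : Measurable W) (hgm : Measurable g) (hhm : Measurable h) (hbm : Measurable b) (hWl : ∀ y ∈ K, w₀ ≤ W y) (hgb : ∀ y ∈ K, |g y| ≤ G)
    (hhb : ∀ y ∈ K, |h y| ≤ H) (hbb : ∀ y ∈ K, |b y| ≤ B₀) (hr : 0 < r)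
    (hconv : ConvexOn ℝ (Ioo (-r) r ×ˢ K) (fun p : ℝ × EuclideanSpace ℝ (Fin n) => W p.2 + p.1 * g p.2 + p.1 ^ 2 / 2 * h p.2)) :
    (∫ y in K, (b y - h y) * exp (-W y)) / (∫ y in K, exp (-W y)) ≤
      -(∫ y in K, exp (-W y) * (g y ^ 2 - b y)) / (∫ y in K, exp (-W y)) + (∫ y in K, -(exp (-W y) * g y)) ^ 2 / (∫ y in K, exp (-W y)) ^ 2 := by
  haveI : NeZero (volume.restrict K) := ⟨fun h0 => hK0 (Measure.restrict_eq_zero.1 h0)⟩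
  have key := mul_setIntegral_sq_sub_sq_le_of_convexOn hK hKm hKb hWm hgm hhm hWl hgb hhb hr hconv
  have hZi : IntegrableOn (fun y => exp (-W y)) K := by simpa using integrableOn_exp_neg_slab hKm hKb hWm hgm hhm hWl hgb hhb (x := 0) (by norm_num)
  have hZpos : 0 < ∫ y in K, exp (-W y) := integral_exp_pos hZi
  have hgi : IntegrableOn (fun y => g y ^ 2 * exp (-W y)) K :=
    integrableOn_mul_exp_neg hKm hKb hWm hWl (hgm.pow_const 2) (C := G ^ 2) fun y hy => by rw [abs_pow]; exact pow_le_pow_left₀ (abs_nonneg _) (hgb y hy) 2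
  have hhi : IntegrableOn (fun y => h y * exp (-W y)) K := integrableOn_mul_exp_neg hKm hKb hWm hWl hhm hhb
  have hbi : IntegrableOn (fun y => b y * exp (-W y)) K := integrableOn_mul_exp_neg hKm hKb hWm hWl hbm hbb
  have eA : (∫ y in K, -(exp (-W y) * g y)) = -∫ y in K, g y * exp (-W y) := by
    rw [← integral_neg]
    exact integral_congr_ae (ae_of_all _ fun y => by ring)
  have eB : (∫ y in K, exp (-W y) * (g y ^ 2 - b y)) = (∫ y in K, g y ^ 2 * exp (-W y)) - ∫ y in K, b y * exp (-W y) := by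
    rw [← integral_sub hgi hbi]
    exact integral_congr_ae (ae_of_all _ fun y => by ring)
  have eC : (∫ y in K, (b y - h y) * exp (-W y)) = (∫ y in K, b y * exp (-W y)) - ∫ y in K, h y * exp (-W y) := by
    rw [← integral_sub hbi hhi]
    exact integral_congr_ae (ae_of_all _ fun y => by ring)
  rw [eA, eB, eC]
  set Z : ℝ := ∫ y in K, exp (-W y)
  set A : ℝ := ∫ y in K, g y * exp (-W y)
  set Bg : ℝ := ∫ y in K, g y ^ 2 * exp (-W y)
  set Bb : ℝ := ∫ y in K, b y * exp (-W y)
  set D : ℝ := ∫ y in K, h y * exp (-W y)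
  have hZne : Z ≠ 0 := hZpos.ne'
  rw [show (Bb - D) / Z = (Z * (Bb - D)) / Z ^ 2 by field_simp, show -(Bg - Bb) / Z + (-A) ^ 2 / Z ^ 2 = (-(Z * (Bg - Bb)) + A ^ 2) / Z ^ 2 by field_simp]
  exact div_le_div_of_nonneg_right (by nlinarith [key]) (sq_nonneg Z)

/-- **THE SLAB LETTER FROM A FIRST-ORDER LETTER** (any real vector space, any field of linear functionals): `f x + L x (y − x) ≤ f y` for `x, y ∈ S`, `S` convex
⟹ `f` convex on `S` — the entry point for a Hessian display through `…NE7b.HessianFormFirstOrder` §1 (`Q = 0`, `L = fderiv ℝ f`). [folklore] -/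
theorem convexOn_of_firstOrder {E : Type*} [AddCommGroup E] [Module ℝ E] {S : Set E} (hS : Convex ℝ S) {f : E → ℝ} (L : E → E →ₗ[ℝ] ℝ)
    (hL : ∀ x ∈ S, ∀ y ∈ S, f x + L x (y - x) ≤ f y) : ConvexOn ℝ S f := by
  refine ⟨hS, fun x hx y hy a c ha hc hac => ?_⟩
  set z : E := a • x + c • y with hz
  have hzS : z ∈ S := hS hx hy ha hc hac
  have h1 := hL z hzS x hx
  have h2 := hL z hzS y hy
  have hsum : a * L z (x - z) + c * L z (y - z) = 0 := by
    rw [← smul_eq_mul, ← smul_eq_mul, ← LinearMap.map_smul, ← LinearMap.map_smul, ← LinearMap.map_add]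
    have : a • (x - z) + c • (y - z) = 0 := by
      rw [hz, show c = 1 - a by linarith]
      module
    rw [this, LinearMap.map_zero]
  have h1' := mul_le_mul_of_nonneg_left h1 ha
  have h2' := mul_le_mul_of_nonneg_left h2 hc
  have : (a + c) * f z ≤ a * f x + c * f y := by nlinarith [h1', h2', hsum]
  rw [hac, one_mul] at this
  simpa [smul_eq_mul] using this

end Main

end Summit.QuantumFields.BalabanUV.T4Continuum.NE7b.ConvexWindowVarianceMajorant
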